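import Summits.QuantumFields.BalabanUV.Beta.D1BFx.ChartDefectRowMsScales
import Summits.QuantumFields.BalabanUV.Beta.D1BFx.ChartDefectRowMcolMass
import Summits.QuantumFields.BalabanUV.Beta.D1BFx.ChartDefectTwoPinsRest

/-!
# `BalabanUV.Beta.D1BFx.ChartDefectRowMcolScales` — road «BF-x», binder row D1, PART 24-hyb HEAD ON THE SCALES (`ChartDefectHeadScales`' rows): **ROW (mcol) WITH ONE
# m-INDEPENDENT CONSTANT, AT THE PIN** (leaf-03 g34, TT35; the scales form of TT27b `ChartDefectRowMcolMass`, sibling of TT33∕TT34).  At every scale `n = Lc^m` the (mcol) row kernel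
# `Wmcol m a e z := ½·tadpole G₀ ((mixOfK G₀ n M₂⁰ a 0 e z − mixOfK K₀ n M₂⁰ a 0 e z) + (mixOfK G₀ n M₂⁰ e z a 0 − mixOfK K₀ n M₂⁰ e z a 0))` (the pin `hWmcol` of
# `ChartDefectHeadScales.abs_secondMoment_chartDefect_scales_le_of_rows`, VERBATIM up to bound-variable names) has absolutely summable (1.22) second moments and
# `|secondMoment (Wmcol m) μ ν| ≤ C_mcol*` with `C_mcol*` FIXED BEFORE `∀ m` — modulo the straight kernel's m-uniform sup letter `∀ m, Bdd (KInvStep 3 (Lc^m) 0) S₀` and the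
# multiplier-column envelope `hΦ` (one `CΦ`, `κ₀ > 0`): `C_mcol* = ((1∕2)·(S₀·(2·G_c*·(289·MV_H*) + 2·G_c*·(289·MV_H*))))·Σ'_x |x|₁²e^{−(κ₁∕16)|x|₁}`, `κ₁ := min κ′ κ₀`,
# `G_c* = 2·(4·C₄·e^{κ′})·e^{κ′∕2}` (TT27b's unit-column-gauge envelope `G_c(n) = (2∕n⁴)·(4·C₄·e^{κ′})·e^{r_G·2n}`, `r_G·2n = κ′∕2` EXACTLY), `MV_H* = K_Φ·(200·e^{κ₁})` (TT34).
HOW.  Per scale: TT27b v1.2 `decay510_row_mcol_mass_of_wmass` (the BRACKET form `½·tadpole G₀ ([Λ′ e z, V′_H a 0] + [Λ′ a 0, V′_H e z])`) at `σ_m := κ₁∕(16·Lc^m)` with `hV :=` g63 PART B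
`wmass_vertexOfM_K₀_symHessFFAt_le_pairMass` and `hG :=` g63 `bdd_G₀_of_bdd`, moved to THE PIN by the OWNER d1-p2's Rest (iii) `ChartDefectTwoPinsRest.tadpole_WMcol_record_eq` (pointwise
`rw`), rate `(Lc^m)·σ_m = κ₁∕16`, the constant majorised by §1 (`G_c(n) ≤ G_c*`) and TT34 `vertexMassConst_dressed_le` (`(1+16n)²·MV_H(n) ≤ 289·MV_H*`) on abstracted atoms, lit
`decay510_mono_const ∕ absMoment₂_of_decay510 ∕ secondMoment_abs_le_of_decay510`.  [folklore] real-inequality bookkeeping BY NAME; no definition, no `def … : Prop`, nothing cited, 0 sorry.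
LOCATED (zero weight): `C_mcol(n) ≍ S₀·CΦ·n⁻⁸`; the constant is its `n = 1` value.

HONEST DEPENDENCY (cell records, verbatim): «continuum YM on T⁴ ⇐ BetaPertH ∧ nine spine estimates (0/9 proved); BetaPertH ⇐ (D1) ∧ (D4) ∧
CAP+tail; G-an2-4 gates asym, D1 and NE2/3/4.»  HONEST FRAMING (cell contract, verbatim): «discharging `BetaPertH` makes Bałaban's UV stability
UNCONDITIONAL — a real constructive-QFT result; it is NOT the continuum limit and NOT the Clay problem.»  ONE displayed row of the HEAD-on-the-scales priced MODULO two displayed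
m-uniform letters (`S₀`, `hΦ`) whose provenance is NOT discharged here — per-word INTERMEDIATE (an2 R-D1-g45-4 (3)), not the HEAD, not the END.  0∕4 row-D1 binders
(hW ∕ hR ∕ D1Tel ∕ D1Rep); (J1) ONE OPEN ROW (eight displayed rows); (K) NOT closed; NOT D1, NEVER «G-an2-4 closed», NOT `BetaPertH`, NOT continuum, NOT Clay.

ABSOLUTE RULE (cell charter, verbatim): «No internally-minted statement may enter as a cited fact. Every hypothesis is either kernel-proved in
this package or a verbatim quotation of a PUBLISHED theorem with page reference. The manuscript(s) under audit are NOT citable for their own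
disputed steps — they are the thing under adjudication; programme-internal (2001/route/tribunal) claims are never citable.»

Unit `b2b-balaban-beta-d1-formalise-leaf-03` (gen 34), D1 formalisation swarm LEAF PROVER 03, road «BF-x»; 2026-08-24.  No existing file touched.
-/

noncomputable section

namespace Summit.QuantumFields.BalabanUV.Beta.D1BFx.ChartDefectRowMcolScales

open Finset
open scoped BigOperators
open Literature.MathematicalPhysics.QuantumFieldTheory
open Literature.MathematicalPhysics.QuantumFieldTheory.Balaban1983to89
open Literature.MathematicalPhysics.QuantumFieldTheory.Balaban1983to89.Beta
open B12Sec2to5 (l1 l1_nonneg Decay510 secondMoment_abs_le_of_decay510)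
open DecimatedMomentSummable (AbsMoment₂ absMoment₂_of_decay510)
open B4ContourShift (supNorm)
open B5Hk163Strip (kappa163 kappa163_pos)
open B5Hk163Decay (MG163)
open B4TorusKernel (periodConst)
open ExpKernelCalculus (Site MKer Zl Zl_nonneg comp tadpole decay510_mono_const)
open AveragingHessianKernels (ell)
open AffineAveraging (box toSite)
open AveragingContours (blk)
open AveragingContoursRooted (ctr ctrOff ctrOff_mem_box)
open KernelSpecInstance (wΦ)
open KernelWard (Bdd)
open OneStepResolventKernel (Fib KInv)
open OneStepKernelFamily (colH KInvStep vertexOfK)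
open SecondOrderResponse (vertexOfM mixOfK)
open Summit.QuantumFields.BalabanUV.Beta.BorderedHessian (diagK)
open Summit.QuantumFields.BalabanUV.Beta.AxialDressingRooted (coDressKBmAt)
open Summit.QuantumFields.BalabanUV.Beta.AveragingWardRootedStencils (legSite)
open Summit.QuantumFields.BalabanUV.Beta.CompositeCorrectorLocality (blockSitesF)
open Summit.QuantumFields.BalabanUV.Beta.SymAveragingHessianCounts (symVhSAt symHessFFAt)
open Summit.QuantumFields.BalabanUV.Beta.SymCorrectorFace (faceWt)
open Summit.QuantumFields.BalabanUV.Beta.D1BFx.RoadPinKernelBdd (bdd_G₀_of_bdd)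
open Summit.QuantumFields.BalabanUV.Beta.D1BFx.SymHessTableMass (wmass_vertexOfM_K₀_symHessFFAt_le_pairMass)
open BalabanStepW2 (M2Of)
open Summit.QuantumFields.BalabanUV.Beta.AxialProjectorBlockMean (bmGaugeAt)
open Summit.QuantumFields.BalabanUV.Beta.SymSecondOrderTablesAn1 (symTablesAn1S2)
open Summit.QuantumFields.BalabanUV.Beta.D1BFx.ChartDefectRowMcolMass (decay510_row_mcol_mass_of_wmass abs_unitColGen_legSite_le)
open Summit.QuantumFields.BalabanUV.Beta.D1BFx.ChartDefectTwoPinsRest (tadpole_WMcol_record_eq)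
open Summit.QuantumFields.BalabanUV.Beta.D1BFx.ChartDefectRowMsScales (vertexMassConst_dressed_le)

variable {d : ℕ}

/-! ## §1 The m-independent majorants (`n ≥ 1`) -/

section Majorants

variable (n : ℕ) [NeZero n]

/-- [folklore] **THE UNIT COLUMN-GAUGE GENERATOR `Λ′`'s ENVELOPE, m-INDEPENDENT MAJORANT**: `G_c(n) = (2∕n⁴)·(4·C₄·e^{κ′})·e^{r_G·(4n∕2)} ≤ G_c* := 2·(4·C₄·e^{κ′})·e^{κ′∕2}`
(`r_G·2n = κ′∕2` exactly, `2∕n⁴ ≤ 2`; TT27b's displayed constant, `1 ≤ n`). -/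
theorem colGenConst_le (hn : 1 ≤ n) :
    ((2 / (n : ℝ) ^ 4 * (4 * (MG163 (3 + 1) * periodConst (kappa163 (3 + 1)) 3) * Real.exp (kappa163 (3 + 1) / ((3 : ℝ) + 1))))
              * Real.exp (kappa163 (3 + 1) / ((3 : ℝ) + 1) / (((3 : ℝ) + 1) * (n : ℝ)) * ((((3 : ℕ) : ℝ) + 1) * (n : ℝ) / 2))) ≤ ((2 * (4 * (MG163 (3 + 1) * periodConst (kappa163 (3 + 1)) 3) * Real.exp (kappa163 (3 + 1) / ((3 : ℝ) + 1)))) * Real.exp (kappa163 (3 + 1) / ((3 : ℝ) + 1) / 2)) := by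
  have hn0 : (n : ℝ) ≠ 0 := by exact_mod_cast (NeZero.ne n)
  have hnpos : (0 : ℝ) < n := by exact_mod_cast hn
  have hn1 : (1 : ℝ) ≤ n := by exact_mod_cast hn
  have hK : 0 ≤ (4 * (MG163 (3 + 1) * periodConst (kappa163 (3 + 1)) 3) * Real.exp (kappa163 (3 + 1) / ((3 : ℝ) + 1))) := by
    have h := (abs_nonneg _).trans (abs_unitColGen_legSite_le n hn 0 0 0 (Sum.inl 0))
    have h' := (mul_nonneg_iff_of_pos_right (Real.exp_pos _)).1 h
    have h'' := (mul_nonneg_iff_of_pos_right (Real.exp_pos _)).1 h'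
    have h2 : (0 : ℝ) < 2 / (n : ℝ) ^ 4 := by positivity
    exact (mul_nonneg_iff_of_pos_left h2).1 h''
  have hexp : Real.exp (kappa163 (3 + 1) / ((3 : ℝ) + 1) / (((3 : ℝ) + 1) * (n : ℝ)) * ((((3 : ℕ) : ℝ) + 1) * (n : ℝ) / 2))
      = Real.exp (kappa163 (3 + 1) / ((3 : ℝ) + 1) / 2) := by
    congr 1; push_cast; field_simp
  rw [hexp]
  refine mul_le_mul_of_nonneg_right ?_ (Real.exp_pos _).le
  have h4 : 2 / (n : ℝ) ^ 4 ≤ 2 := by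
    rw [div_le_iff₀ (by positivity)]
    nlinarith [one_le_pow₀ (M₀ := ℝ) hn1 (n := 4)]
  exact mul_le_mul_of_nonneg_right h4 hK

/-- [folklore] The majorant `G_c*` is non-negative (`1 ≤ n` witnesses `0 ≤ 4·C₄·e^{κ′}` through TT27b's envelope). -/
theorem colGenStar_nonneg (hn : 1 ≤ n) : 0 ≤ ((2 * (4 * (MG163 (3 + 1) * periodConst (kappa163 (3 + 1)) 3) * Real.exp (kappa163 (3 + 1) / ((3 : ℝ) + 1)))) * Real.exp (kappa163 (3 + 1) / ((3 : ℝ) + 1) / 2)) := by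
  have hK : 0 ≤ (4 * (MG163 (3 + 1) * periodConst (kappa163 (3 + 1)) 3) * Real.exp (kappa163 (3 + 1) / ((3 : ℝ) + 1))) := by
    have h := (abs_nonneg _).trans (abs_unitColGen_legSite_le n hn 0 0 0 (Sum.inl 0))
    have h' := (mul_nonneg_iff_of_pos_right (Real.exp_pos _)).1 h
    have h'' := (mul_nonneg_iff_of_pos_right (Real.exp_pos _)).1 h'
    have hnpos : (0 : ℝ) < n := by exact_mod_cast hn
    have h2 : (0 : ℝ) < 2 / (n : ℝ) ^ 4 := by positivity
    exact (mul_nonneg_iff_of_pos_left h2).1 h''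
  positivity

end Majorants

/-! ## §2 Row (mcol) on the scales: ONE constant for every `m`, at the pin -/

section Scales

variable {Lc : ℕ} [NeZero Lc]

/-- **ROW (mcol) ON THE SCALES WITH ONE m-INDEPENDENT CONSTANT, AT THE PIN** [our objects + folklore] — the `hAmcol ∕ hBmcol` binders of
`ChartDefectHeadScales.abs_secondMoment_chartDefect_scales_le_of_rows` (pin `hWmcol := fun _ _ _ _ ↦ rfl`; `cΛ : ℕ → ℝ` enters the pin only through an1's closed record
`symTablesAn1S2 3 (Lc^m) (cΛ m)`, no bound on it is needed): modulo `hK₀ : ∀ m, Bdd (KInvStep 3 (Lc^m) 0) S₀` (`0 ≤ S₀`) and `hΦ` (`0 ≤ CΦ`, `0 < κ₀`), for every `m` the scale-`m` (mcol) row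
kernel has absolutely summable (1.22) second moments and `|secondMoment (Wmcol m) μ ν| ≤ C_mcol*`. -/
theorem row_mcol_scales (cΛ : ℕ → ℝ) {S₀ : ℝ} (hS₀ : 0 ≤ S₀) (hK₀ : ∀ m : ℕ, Bdd (KInvStep (d := 3) (Lc ^ m) 0) S₀)
    {CΦ κ₀ : ℝ} (hCΦ : 0 ≤ CΦ) (hκ₀ : 0 < κ₀)
    (hΦ : ∀ (m : ℕ) (ρ ν : Fin (3 + 1)) (w : Fin (3 + 1) → ℤ),
      |wΦ (N := Lc ^ m) ρ ν w| ≤ CΦ * (((Lc ^ m : ℕ) : ℝ) ^ 5)⁻¹ * (((Lc ^ m : ℕ) : ℝ) ^ 3)⁻¹ * Real.exp (-(κ₀ * supNorm w)))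
    (μ ν : Fin (3 + 1)) :
    (∀ (m : ℕ) (a e : Fin (3 + 1)), AbsMoment₂ (fun z : Site 4 => (1 / 2 : ℝ) * tadpole (coDressKBmAt (ctr 4 (Lc ^ m)) (Lc ^ m) (KInvStep (d := 3) (Lc ^ m) 0)) (((mixOfK (coDressKBmAt (ctr 4 (Lc ^ m)) (Lc ^ m) (KInvStep (d := 3) (Lc ^ m) 0)) (Lc ^ m) (M2Of 3 (Lc ^ m) (symTablesAn1S2 3 (Lc ^ m) (cΛ m)).mixFF 0) a 0 e z
                - mixOfK (KInvStep (d := 3) (Lc ^ m) 0) (Lc ^ m) (M2Of 3 (Lc ^ m) (symTablesAn1S2 3 (Lc ^ m) (cΛ m)).mixFF 0) a 0 e z)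
            + (mixOfK (coDressKBmAt (ctr 4 (Lc ^ m)) (Lc ^ m) (KInvStep (d := 3) (Lc ^ m) 0)) (Lc ^ m) (M2Of 3 (Lc ^ m) (symTablesAn1S2 3 (Lc ^ m) (cΛ m)).mixFF 0) e z a 0
                - mixOfK (KInvStep (d := 3) (Lc ^ m) 0) (Lc ^ m) (M2Of 3 (Lc ^ m) (symTablesAn1S2 3 (Lc ^ m) (cΛ m)).mixFF 0) e z a 0))))) ∧
      ∀ m : ℕ, |B12Beta.secondMoment (fun (a e : Fin (3 + 1)) (z : Site 4) => (1 / 2 : ℝ) * tadpole (coDressKBmAt (ctr 4 (Lc ^ m)) (Lc ^ m) (KInvStep (d := 3) (Lc ^ m) 0)) (((mixOfK (coDressKBmAt (ctr 4 (Lc ^ m)) (Lc ^ m) (KInvStep (d := 3) (Lc ^ m) 0)) (Lc ^ m) (M2Of 3 (Lc ^ m) (symTablesAn1S2 3 (Lc ^ m) (cΛ m)).mixFF 0) a 0 e z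
                - mixOfK (KInvStep (d := 3) (Lc ^ m) 0) (Lc ^ m) (M2Of 3 (Lc ^ m) (symTablesAn1S2 3 (Lc ^ m) (cΛ m)).mixFF 0) a 0 e z)
            + (mixOfK (coDressKBmAt (ctr 4 (Lc ^ m)) (Lc ^ m) (KInvStep (d := 3) (Lc ^ m) 0)) (Lc ^ m) (M2Of 3 (Lc ^ m) (symTablesAn1S2 3 (Lc ^ m) (cΛ m)).mixFF 0) e z a 0
                - mixOfK (KInvStep (d := 3) (Lc ^ m) 0) (Lc ^ m) (M2Of 3 (Lc ^ m) (symTablesAn1S2 3 (Lc ^ m) (cΛ m)).mixFF 0) e z a 0)))) μ ν|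
        ≤ ((1 / 2 : ℝ) * (S₀ * (2 * ((2 * (4 * (MG163 (3 + 1) * periodConst (kappa163 (3 + 1)) 3) * Real.exp (kappa163 (3 + 1) / ((3 : ℝ) + 1)))) * Real.exp (kappa163 (3 + 1) / ((3 : ℝ) + 1) / 2)) * (289 * ((4 * CΦ * Real.exp κ₀ * Real.exp (κ₀ / 2) * Zl 4 (κ₀ / 8)) * (2 * 100 * Real.exp (min (kappa163 4 / 4) κ₀))))
            + 2 * ((2 * (4 * (MG163 (3 + 1) * periodConst (kappa163 (3 + 1)) 3) * Real.exp (kappa163 (3 + 1) / ((3 : ℝ) + 1)))) * Real.exp (kappa163 (3 + 1) / ((3 : ℝ) + 1) / 2)) * (289 * ((4 * CΦ * Real.exp κ₀ * Real.exp (κ₀ / 2) * Zl 4 (κ₀ / 8)) * (2 * 100 * Real.exp (min (kappa163 4 / 4) κ₀)))))))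
          * ∑' x : Site 4, l1 x ^ 2 * Real.exp (-((min (kappa163 4 / 4) κ₀) / 16) * l1 x) := by
  have hκ : 0 < kappa163 4 := kappa163_pos 4
  have hκ1 : 0 < (min (kappa163 4 / 4) κ₀) := lt_min (by positivity) hκ₀
  have hrate : (0 : ℝ) < (min (kappa163 4 / 4) κ₀) / 16 := by positivity
  have hGs0 : 0 ≤ ((2 * (4 * (MG163 (3 + 1) * periodConst (kappa163 (3 + 1)) 3) * Real.exp (kappa163 (3 + 1) / ((3 : ℝ) + 1)))) * Real.exp (kappa163 (3 + 1) / ((3 : ℝ) + 1) / 2)) := colGenStar_nonneg 1 le_rfl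
  have key : ∀ (m : ℕ) (a e : Fin (3 + 1)), Decay510 (fun z : Site 4 => (1 / 2 : ℝ) * tadpole (coDressKBmAt (ctr 4 (Lc ^ m)) (Lc ^ m) (KInvStep (d := 3) (Lc ^ m) 0)) (((mixOfK (coDressKBmAt (ctr 4 (Lc ^ m)) (Lc ^ m) (KInvStep (d := 3) (Lc ^ m) 0)) (Lc ^ m) (M2Of 3 (Lc ^ m) (symTablesAn1S2 3 (Lc ^ m) (cΛ m)).mixFF 0) a 0 e z
                - mixOfK (KInvStep (d := 3) (Lc ^ m) 0) (Lc ^ m) (M2Of 3 (Lc ^ m) (symTablesAn1S2 3 (Lc ^ m) (cΛ m)).mixFF 0) a 0 e z)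
            + (mixOfK (coDressKBmAt (ctr 4 (Lc ^ m)) (Lc ^ m) (KInvStep (d := 3) (Lc ^ m) 0)) (Lc ^ m) (M2Of 3 (Lc ^ m) (symTablesAn1S2 3 (Lc ^ m) (cΛ m)).mixFF 0) e z a 0
                - mixOfK (KInvStep (d := 3) (Lc ^ m) 0) (Lc ^ m) (M2Of 3 (Lc ^ m) (symTablesAn1S2 3 (Lc ^ m) (cΛ m)).mixFF 0) e z a 0))))
      ((1 / 2 : ℝ) * (S₀ * (2 * ((2 * (4 * (MG163 (3 + 1) * periodConst (kappa163 (3 + 1)) 3) * Real.exp (kappa163 (3 + 1) / ((3 : ℝ) + 1)))) * Real.exp (kappa163 (3 + 1) / ((3 : ℝ) + 1) / 2)) * (289 * ((4 * CΦ * Real.exp κ₀ * Real.exp (κ₀ / 2) * Zl 4 (κ₀ / 8)) * (2 * 100 * Real.exp (min (kappa163 4 / 4) κ₀))))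
            + 2 * ((2 * (4 * (MG163 (3 + 1) * periodConst (kappa163 (3 + 1)) 3) * Real.exp (kappa163 (3 + 1) / ((3 : ℝ) + 1)))) * Real.exp (kappa163 (3 + 1) / ((3 : ℝ) + 1) / 2)) * (289 * ((4 * CΦ * Real.exp κ₀ * Real.exp (κ₀ / 2) * Zl 4 (κ₀ / 8)) * (2 * 100 * Real.exp (min (kappa163 4 / 4) κ₀))))))) ((min (kappa163 4 / 4) κ₀) / 16) := by
    intro m a e
    have hn1 : 1 ≤ Lc ^ m := Nat.one_le_iff_ne_zero.2 (pow_ne_zero _ (NeZero.ne Lc))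
    have hnpos : (0 : ℝ) < ((Lc ^ m : ℕ) : ℝ) := by exact_mod_cast hn1
    have hσpos : (0 : ℝ) < (min (kappa163 4 / 4) κ₀) / (16 * ((Lc ^ m : ℕ) : ℝ)) := by positivity
    have hσr : (min (kappa163 4 / 4) κ₀) / (16 * ((Lc ^ m : ℕ) : ℝ)) ≤ kappa163 (3 + 1) / ((3 : ℝ) + 1) / (((3 : ℝ) + 1) * ((Lc ^ m : ℕ) : ℝ)) := by
      have er : kappa163 (3 + 1) / ((3 : ℝ) + 1) / (((3 : ℝ) + 1) * ((Lc ^ m : ℕ) : ℝ)) = kappa163 4 / 4 / (4 * ((Lc ^ m : ℕ) : ℝ)) := by norm_num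
      rw [er, div_le_div_iff₀ (by positivity) (by positivity)]
      have hm : (min (kappa163 4 / 4) κ₀) ≤ kappa163 4 / 4 := min_le_left _ _
      nlinarith
    have hσΦ : (min (kappa163 4 / 4) κ₀) / (16 * ((Lc ^ m : ℕ) : ℝ)) ≤ κ₀ / (16 * ((Lc ^ m : ℕ) : ℝ)) :=
      div_le_div_of_nonneg_right (min_le_right _ _) (by positivity)
    have hG := bdd_G₀_of_bdd (Lc ^ m) (hK₀ m)
    have hS : (0 : ℝ) ≤ (1 + 4 * (((3 : ℝ) + 1) * ((Lc ^ m : ℕ) : ℝ))) ^ 2 * S₀ := by positivity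
    have hV := fun ν' y' => wmass_vertexOfM_K₀_symHessFFAt_le_pairMass (Lc ^ m) hκ₀ (hΦ m) hσpos.le hσΦ ν' y'
    have h0 := decay510_row_mcol_mass_of_wmass (Lc ^ m) hn1 hG hS hσpos hσr hV a e
    -- move to the pin (the OWNER's Rest (iii) identity, pointwise)
    have h : Decay510 (fun z : Site 4 => (1 / 2 : ℝ) * tadpole (coDressKBmAt (ctr 4 (Lc ^ m)) (Lc ^ m) (KInvStep (d := 3) (Lc ^ m) 0)) (((mixOfK (coDressKBmAt (ctr 4 (Lc ^ m)) (Lc ^ m) (KInvStep (d := 3) (Lc ^ m) 0)) (Lc ^ m) (M2Of 3 (Lc ^ m) (symTablesAn1S2 3 (Lc ^ m) (cΛ m)).mixFF 0) a 0 e z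
                - mixOfK (KInvStep (d := 3) (Lc ^ m) 0) (Lc ^ m) (M2Of 3 (Lc ^ m) (symTablesAn1S2 3 (Lc ^ m) (cΛ m)).mixFF 0) a 0 e z)
            + (mixOfK (coDressKBmAt (ctr 4 (Lc ^ m)) (Lc ^ m) (KInvStep (d := 3) (Lc ^ m) 0)) (Lc ^ m) (M2Of 3 (Lc ^ m) (symTablesAn1S2 3 (Lc ^ m) (cΛ m)).mixFF 0) e z a 0
                - mixOfK (KInvStep (d := 3) (Lc ^ m) 0) (Lc ^ m) (M2Of 3 (Lc ^ m) (symTablesAn1S2 3 (Lc ^ m) (cΛ m)).mixFF 0) e z a 0))))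
        ((1 / 2 : ℝ) * ((1 + 4 * (((3 : ℝ) + 1) * ((Lc ^ m : ℕ) : ℝ))) ^ 2 * S₀ * (2 * ((2 / ((Lc ^ m : ℕ) : ℝ) ^ 4 * (4 * (MG163 (3 + 1) * periodConst (kappa163 (3 + 1)) 3) * Real.exp (kappa163 (3 + 1) / ((3 : ℝ) + 1))))
              * Real.exp (kappa163 (3 + 1) / ((3 : ℝ) + 1) / (((3 : ℝ) + 1) * ((Lc ^ m : ℕ) : ℝ)) * ((((3 : ℕ) : ℝ) + 1) * ((Lc ^ m : ℕ) : ℝ) / 2))) * (((((Lc ^ m : ℕ) : ℝ) ^ 5)⁻¹ * (((Lc ^ m : ℕ) : ℝ) ^ 3)⁻¹) * (4 * CΦ * Real.exp κ₀ * Real.exp (κ₀ / 2) * Zl 4 (κ₀ / 8))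
            * (2 * (ell (3 + 1) (Lc ^ m) : ℝ) ^ 2 * Real.exp (((min (kappa163 4 / 4) κ₀) / (16 * ((Lc ^ m : ℕ) : ℝ))) * (4 * (((3 : ℝ) + 1) * ((Lc ^ m : ℕ) : ℝ))))))
            + 2 * ((2 / ((Lc ^ m : ℕ) : ℝ) ^ 4 * (4 * (MG163 (3 + 1) * periodConst (kappa163 (3 + 1)) 3) * Real.exp (kappa163 (3 + 1) / ((3 : ℝ) + 1))))
              * Real.exp (kappa163 (3 + 1) / ((3 : ℝ) + 1) / (((3 : ℝ) + 1) * ((Lc ^ m : ℕ) : ℝ)) * ((((3 : ℕ) : ℝ) + 1) * ((Lc ^ m : ℕ) : ℝ) / 2))) * (((((Lc ^ m : ℕ) : ℝ) ^ 5)⁻¹ * (((Lc ^ m : ℕ) : ℝ) ^ 3)⁻¹) * (4 * CΦ * Real.exp κ₀ * Real.exp (κ₀ / 2) * Zl 4 (κ₀ / 8))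
            * (2 * (ell (3 + 1) (Lc ^ m) : ℝ) ^ 2 * Real.exp (((min (kappa163 4 / 4) κ₀) / (16 * ((Lc ^ m : ℕ) : ℝ))) * (4 * (((3 : ℝ) + 1) * ((Lc ^ m : ℕ) : ℝ))))))))) (((Lc ^ m : ℕ) : ℝ) * ((min (kappa163 4 / 4) κ₀) / (16 * ((Lc ^ m : ℕ) : ℝ)))) := by
      intro z
      have hz := h0 z
      dsimp only at hz ⊢
      rw [tadpole_WMcol_record_eq (n := Lc ^ m) (cΛ m) a 0 e z]
      exact hz
    have erate : ((Lc ^ m : ℕ) : ℝ) * ((min (kappa163 4 / 4) κ₀) / (16 * ((Lc ^ m : ℕ) : ℝ))) = (min (kappa163 4 / 4) κ₀) / 16 := by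
      field_simp
    rw [erate] at h
    -- the constant is majorised uniformly in `m` (atoms abstracted before the algebra)
    have hGT := colGenConst_le (Lc ^ m) hn1
    have hMV := vertexMassConst_dressed_le (Lc ^ m) hn1 hCΦ hκ₀
    set G : ℝ := ((2 * (4 * (MG163 (3 + 1) * periodConst (kappa163 (3 + 1)) 3) * Real.exp (kappa163 (3 + 1) / ((3 : ℝ) + 1)))) * Real.exp (kappa163 (3 + 1) / ((3 : ℝ) + 1) / 2)) with hGdef
    set GT : ℝ := ((2 / ((Lc ^ m : ℕ) : ℝ) ^ 4 * (4 * (MG163 (3 + 1) * periodConst (kappa163 (3 + 1)) 3) * Real.exp (kappa163 (3 + 1) / ((3 : ℝ) + 1))))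
              * Real.exp (kappa163 (3 + 1) / ((3 : ℝ) + 1) / (((3 : ℝ) + 1) * ((Lc ^ m : ℕ) : ℝ)) * ((((3 : ℕ) : ℝ) + 1) * ((Lc ^ m : ℕ) : ℝ) / 2))) with hGTdef
    set MVs : ℝ := ((4 * CΦ * Real.exp κ₀ * Real.exp (κ₀ / 2) * Zl 4 (κ₀ / 8)) * (2 * 100 * Real.exp (min (kappa163 4 / 4) κ₀))) with hMVsdef
    set MV : ℝ := (((((Lc ^ m : ℕ) : ℝ) ^ 5)⁻¹ * (((Lc ^ m : ℕ) : ℝ) ^ 3)⁻¹) * (4 * CΦ * Real.exp κ₀ * Real.exp (κ₀ / 2) * Zl 4 (κ₀ / 8))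
            * (2 * (ell (3 + 1) (Lc ^ m) : ℝ) ^ 2 * Real.exp (((min (kappa163 4 / 4) κ₀) / (16 * ((Lc ^ m : ℕ) : ℝ))) * (4 * (((3 : ℝ) + 1) * ((Lc ^ m : ℕ) : ℝ)))))) with hMVdef
    set A : ℝ := (1 + 4 * (((3 : ℝ) + 1) * ((Lc ^ m : ℕ) : ℝ))) ^ 2 with hAdef
    refine decay510_mono_const h ?_
    have hMV0 : 0 ≤ MV := le_trans (tsum_nonneg fun p => mul_nonneg (Finset.sum_nonneg fun a _ => Finset.sum_nonneg fun b _ => abs_nonneg _) (Real.exp_pos _).le) (hV 0 0).2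
    have hMVs0 : 0 ≤ 289 * MVs := le_trans (mul_nonneg (sq_nonneg _) hMV0) hMV
    have hGT0 : 0 ≤ GT := by
      have h1 := (abs_nonneg _).trans (abs_unitColGen_legSite_le (Lc ^ m) hn1 0 0 0 (Sum.inl 0))
      exact (mul_nonneg_iff_of_pos_right (Real.exp_pos _)).1 h1
    have h1 : GT * (A * MV) ≤ G * (289 * MVs) := mul_le_mul hGT hMV (mul_nonneg (sq_nonneg _) hMV0) hGs0
    have h2 : 2 * (GT * (A * MV)) ≤ 2 * (G * (289 * MVs)) := by linarith
    calc (1 / 2 : ℝ) * (A * S₀ * (2 * GT * MV + 2 * GT * MV))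
        = (1 / 2 : ℝ) * (S₀ * (2 * (GT * (A * MV)) + 2 * (GT * (A * MV)))) := by ring
      _ ≤ (1 / 2 : ℝ) * (S₀ * (2 * G * (289 * MVs) + 2 * G * (289 * MVs))) := by
          have h3 : S₀ * (2 * (GT * (A * MV)) + 2 * (GT * (A * MV))) ≤ S₀ * (2 * G * (289 * MVs) + 2 * G * (289 * MVs)) :=
            mul_le_mul_of_nonneg_left (by linarith) hS₀
          linarith
  refine ⟨fun m a e => absMoment₂_of_decay510 hrate (key m a e), fun m => ?_⟩
  exact (secondMoment_abs_le_of_decay510 (P := fun (a e : Fin (3 + 1)) (z : Site 4) => (1 / 2 : ℝ) * tadpole (coDressKBmAt (ctr 4 (Lc ^ m)) (Lc ^ m) (KInvStep (d := 3) (Lc ^ m) 0)) (((mixOfK (coDressKBmAt (ctr 4 (Lc ^ m)) (Lc ^ m) (KInvStep (d := 3) (Lc ^ m) 0)) (Lc ^ m) (M2Of 3 (Lc ^ m) (symTablesAn1S2 3 (Lc ^ m) (cΛ m)).mixFF 0) a 0 e z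
                - mixOfK (KInvStep (d := 3) (Lc ^ m) 0) (Lc ^ m) (M2Of 3 (Lc ^ m) (symTablesAn1S2 3 (Lc ^ m) (cΛ m)).mixFF 0) a 0 e z)
            + (mixOfK (coDressKBmAt (ctr 4 (Lc ^ m)) (Lc ^ m) (KInvStep (d := 3) (Lc ^ m) 0)) (Lc ^ m) (M2Of 3 (Lc ^ m) (symTablesAn1S2 3 (Lc ^ m) (cΛ m)).mixFF 0) e z a 0
                - mixOfK (KInvStep (d := 3) (Lc ^ m) 0) (Lc ^ m) (M2Of 3 (Lc ^ m) (symTablesAn1S2 3 (Lc ^ m) (cΛ m)).mixFF 0) e z a 0)))) hrate (key m μ ν)).2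

end Scales

end Summit.QuantumFields.BalabanUV.Beta.D1BFx.ChartDefectRowMcolScales

end
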